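import Literature.AlgebraicGeometry.Frobenioids.ArchimedeanFSMProjection
import Literature.AlgebraicGeometry.Frobenioids.ArchimedeanFSMCounterexample
import Literature.AlgebraicGeometry.Frobenioids.ArchimedeanFSMCounterexampleA
import Literature.AlgebraicGeometry.Frobenioids.ArchimedeanFSMCounterexampleR
import Literature.AlgebraicGeometry.Frobenioids.ArchimedeanFSMIrreducible
import Literature.AlgebraicGeometry.Frobenioids.ArchimedeanFSMIrreducibleCounterexample
import HarnessLib

/-!
# Frobenioids II, Proposition 3.4 (ii) conditions (a), (b) and item (v): kernel witnesses for the
# FACT-LIST rows F-0804 `Tower.CondA`, F-0805 `Tower.CondB`, F-0811 `Prop34_v`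

Mochizuki, *The geometry of Frobenioids II: poly-Frobenioids*, Kyushu J. Math. **62** (2008)
401–460, §3, Proposition 3.4 (ii) p. 30 [cite: MochizukiFrdII2008, Prop 3.4 (ii) p.30]:

> "(ii) Suppose that `φ` is a monomorphism of `F` that satisfies at least one of the following two
> conditions: (a) `φ` projects to an isomorphism of `D₀`; (b) `φ` admits a factorization `A → A′ → B`
> as a composite of a morphism of Frobenius type `A → A′` and a linear morphism `A′ → B` such that
> any isotropic hull `A′ → A″` of `A′` is either an isomorphism or a slit morphism. Then `φ` projects
> to a monomorphism `φ_D` of `D`."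

and Remark 3.4.1 p. 33: "there exist monomorphisms of `G` [`= N`, `R`] that do not satisfy either of
the conditions of Proposition 3.4, (ii), and which fail to project to monomorphisms of `D`."

PROOF-ONLY companion of `ArchimedeanFSM.lean` (statements, seat abc-iut-L1-t6); nothing is defined
here, no statement of the paper is retyped or strengthened. abc-iut cell, block F (fact-proving
wave), seat f-009, tranche 9 of `plan/F-TRANCHES.tsv`.

The three rows are PARAMETRISED schemata (`kernel_closedness = parametrised`):
* `ArchFrd.Tower.CondA T φ`, `ArchFrd.Tower.CondB T φ` are the two HYPOTHESES (a), (b) of item (ii)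
  — predicates of an arrow `φ` of a tower `T`, never asserted by print for every arrow. Their
  universal closures are FALSE, and print says so (Rmk 3.4.1): PROVED here, for EACH printed tower
  `F = A, N, R` over the printed base `D := D₀`, `π := 𝟭 D₀` (a connected, totally epimorphic
  category: `ArchFrd.D0.isGraphConnected`, `ArchFrd.D0.isTotallyEpimorphic`, p. 23 ll. 13–14),
  there is an FSM-morphism (in particular a monomorphism) of `F` satisfying NEITHER (a) NOR (b) and
  projecting to a non-FSM-morphism of `D` (`towerA_id_exists_fsm_not_condA_not_condB`, `towerN_…`,
  `towerR_…`) — the witnesses are abc-iut-L1-d3's half-circle arrows (`towerA_id_not_propIII`,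
  `N.exists_fsm_witness_id`, `towerR_id_not_propIII`) pushed through the PROVED items (i), (ii)
  (`ArchFrd.prop34_i_holds`, `ArchFrd.prop34_ii_holds`; `Tower.isFSM_toD_of_condA_or_condB`). Hence
  the exact universal-closure refutations `Tower.not_forall_condA`, `Tower.not_forall_condB`
  (R5 / STRIKE trigger), and the refutation over `D₀` of the "observation" of the printed proof of
  (iii), p. 31 ll. 6–9 ("if `φ` is a fiberwise-surjective morphism of `F` that does not satisfy
  condition (a) …, then … `φ` necessarily satisfies condition (b)") — the hypothesis `hobs` of
  `Tower.propIII_of_propI_of_propII` — at each of the three towers (`towerA_id_not_obs`, …).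
  The POSITIVE instance forms the cone consumes are already in the tree and are only cited:
  `Tower.condA_of_isComplex` (complex regime), `Tower.condA_of_isComplex_cod`.
* `ArchFrd.Prop34_v π` (item (v), typed over a BARE base `π : D ⥤ D₀`): its universal closure is
  refuted in the tree at the non-totally-epimorphic base `Type` (`ArchFrd.not_prop34_v_constReal`,
  abc-iut-w4-d092) and it is PROVED under the standing hypothesis of Ex. 3.3 (i) "`D` totally
  epimorphic" (`ArchFrd.prop34_v_of_isTotallyEpimorphic`). Recorded here: the exact universal-closure
  refutation `not_forall_prop34_v` and the binder-exact printed form `prop34_v_printed`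
  ("`D` connected, totally epimorphic", p. 27) together with its instance at the printed base `D₀`
  (`prop34_v_id`).

typed ≠ proved for anything not in this file; a FACT row is an assumption label, not an endorsement;
no side is taken on [IUTchIII] Cor. 3.12.
-/

namespace Literature.AlgebraicGeometry.Frobenioids

open CategoryTheory

noncomputable section

namespace ArchFrd

universe v u

variable {D : Type u} [Category.{v} D] {π : D ⥤ D0}

/-! ### Conditions (a), (b) of Prop. 3.4 (ii): arrows satisfying neither -/

/-- For any tower: an FSM-morphism whose projection to `D` is not an FSM-morphism satisfies neither
condition (a) nor condition (b) of Prop. 3.4 (ii), as soon as items (i), (ii) hold for the tower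
(then (a) or (b) would make the projection FSM, `Tower.isFSM_toD_of_condA_or_condB`).
[cite: MochizukiFrdII2008, Prop 3.4 (ii) p.30] -/
theorem Tower.not_condA_not_condB_of_not_isFSM (T : Tower π) (hI : T.PropI) (hII : T.PropII)
    {X Y : T.F} (φ : X ⟶ Y) (hφ : IsFSM φ) (hD : ¬ IsFSM (T.toD.map φ)) :
    ¬ T.CondA φ ∧ ¬ T.CondB φ :=
  ⟨fun ha => hD (T.isFSM_toD_of_condA_or_condB π hI hII φ hφ (Or.inl ha)),
    fun hb => hD (T.isFSM_toD_of_condA_or_condB π hI hII φ hφ (Or.inr hb))⟩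

/-- For any tower satisfying items (i), (ii) but NOT item (iii): there is an FSM-morphism of `F`
satisfying neither (a) nor (b) whose projection to `D` is not an FSM-morphism.
[cite: MochizukiFrdII2008, Rmk 3.4.1 p.33] -/
theorem Tower.exists_fsm_not_condA_not_condB (T : Tower π) (hI : T.PropI) (hII : T.PropII)
    (hIII : ¬ T.PropIII) :
    ∃ (X Y : T.F) (φ : X ⟶ Y), IsFSM φ ∧ ¬ T.CondA φ ∧ ¬ T.CondB φ ∧ ¬ IsFSM (T.toD.map φ) := by
  by_contra h
  refine hIII fun X Y φ hφ => ?_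
  by_contra hD
  exact h ⟨X, Y, φ, hφ, (T.not_condA_not_condB_of_not_isFSM hI hII φ hφ hD).1,
    (T.not_condA_not_condB_of_not_isFSM hI hII φ hφ hD).2, hD⟩

/-- **Rmk 3.4.1 for `F = A` over `D = D₀`**: an FSM-morphism (hence a monomorphism) of the angular
Frobenioid `A` over `π = 𝟭 D₀` satisfying neither (a) nor (b) of Prop. 3.4 (ii), whose projection to
`D₀` is not an FSM-morphism (abc-iut-L1-d3's half-circle arrow, `towerA_id_not_propIII`).
[cite: MochizukiFrdII2008, Rmk 3.4.1 p.33] -/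
theorem towerA_id_exists_fsm_not_condA_not_condB :
    ∃ (X Y : (towerA (𝟭 D0)).F) (φ : X ⟶ Y), IsFSM φ ∧ ¬ (towerA (𝟭 D0)).CondA φ ∧
      ¬ (towerA (𝟭 D0)).CondB φ ∧ ¬ IsFSM ((towerA (𝟭 D0)).toD.map φ) :=
  (towerA (𝟭 D0)).exists_fsm_not_condA_not_condB (prop34_i_holds (𝟭 D0)).1
    (prop34_ii_holds (𝟭 D0)).1 towerA_id_not_propIII

/-- **Rmk 3.4.1 for `F = N` over `D = D₀`**: an FSM-morphism of the non-rigidified angloid `N` over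
`π = 𝟭 D₀` satisfying neither (a) nor (b), whose projection to `D₀` is not an FSM-morphism
(`N.exists_fsm_witness_id`). [cite: MochizukiFrdII2008, Rmk 3.4.1 p.33] -/
theorem towerN_id_exists_fsm_not_condA_not_condB :
    ∃ (X Y : (towerN (𝟭 D0)).F) (φ : X ⟶ Y), IsFSM φ ∧ ¬ (towerN (𝟭 D0)).CondA φ ∧
      ¬ (towerN (𝟭 D0)).CondB φ ∧ ¬ IsFSM ((towerN (𝟭 D0)).toD.map φ) :=
  (towerN (𝟭 D0)).exists_fsm_not_condA_not_condB (prop34_i_holds (𝟭 D0)).2.1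
    (prop34_ii_holds (𝟭 D0)).2.1 towerN_id_not_propIII

/-- **Rmk 3.4.1 for `F = R` over `D = D₀`**: an FSM-morphism of the rigidified angloid `R` over
`π = 𝟭 D₀` satisfying neither (a) nor (b), whose projection to `D₀` is not an FSM-morphism
(`towerR_id_not_propIII`). [cite: MochizukiFrdII2008, Rmk 3.4.1 p.33] -/
theorem towerR_id_exists_fsm_not_condA_not_condB :
    ∃ (X Y : (towerR (𝟭 D0)).F) (φ : X ⟶ Y), IsFSM φ ∧ ¬ (towerR (𝟭 D0)).CondA φ ∧
      ¬ (towerR (𝟭 D0)).CondB φ ∧ ¬ IsFSM ((towerR (𝟭 D0)).toD.map φ) :=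
  (towerR (𝟭 D0)).exists_fsm_not_condA_not_condB (prop34_i_holds (𝟭 D0)).2.2
    (prop34_ii_holds (𝟭 D0)).2.2 towerR_id_not_propIII

/-! ### F-0804 `Tower.CondA`, F-0805 `Tower.CondB`: the universal closures are false -/

/-- **FACT-LIST F-0804**: the universal closure of condition (a) of Prop. 3.4 (ii) — "every arrow of
every tower projects to an isomorphism of `D₀`" — is FALSE (witness: tower `N` over `𝟭 D₀`). Condition
(a) is a hypothesis of item (ii), not a claim of print; its positive instance forms in the tree are
`Tower.condA_of_isComplex` / `Tower.condA_of_isComplex_cod`. [cite: MochizukiFrdII2008, Prop 3.4 (ii) p.30] -/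
theorem Tower.not_forall_condA :
    ¬ ∀ {D : Type} [Category.{0} D] (π : D ⥤ D0) (T : Tower π) {X Y : T.F} (φ : X ⟶ Y),
      Literature.AlgebraicGeometry.Frobenioids.ArchFrd.Tower.CondA T φ := by
  intro h
  obtain ⟨X, Y, φ, -, ha, -, -⟩ := towerN_id_exists_fsm_not_condA_not_condB
  exact ha (h (𝟭 D0) (towerN (𝟭 D0)) φ)

/-- **FACT-LIST F-0805**: the universal closure of condition (b) of Prop. 3.4 (ii) — "every arrow of
every tower factors as Frobenius-type ∘ linear through an object all of whose isotropic hulls are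
isomorphisms or slit" — is FALSE (witness: tower `N` over `𝟭 D₀`). Condition (b) is a hypothesis of
item (ii), not a claim of print. [cite: MochizukiFrdII2008, Prop 3.4 (ii) p.30] -/
theorem Tower.not_forall_condB :
    ¬ ∀ {D : Type} [Category.{0} D] (π : D ⥤ D0) (T : Tower π) {X Y : T.F} (φ : X ⟶ Y),
      Literature.AlgebraicGeometry.Frobenioids.ArchFrd.Tower.CondB T φ := by
  intro h
  obtain ⟨X, Y, φ, -, -, hb, -⟩ := towerN_id_exists_fsm_not_condA_not_condB
  exact hb (h (𝟭 D0) (towerN (𝟭 D0)) φ)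

/-- Even the dichotomy "(a) or (b)" fails for monomorphisms: over `D = D₀` there are monomorphisms of
`A`, `N`, `R` satisfying neither condition (Rmk 3.4.1, first sentence).
[cite: MochizukiFrdII2008, Rmk 3.4.1 p.33] -/
theorem not_forall_mono_condA_or_condB_id :
    (¬ ∀ {X Y : (towerA (𝟭 D0)).F} (φ : X ⟶ Y), Mono φ →
        (towerA (𝟭 D0)).CondA φ ∨ (towerA (𝟭 D0)).CondB φ) ∧
    (¬ ∀ {X Y : (towerN (𝟭 D0)).F} (φ : X ⟶ Y), Mono φ →
        (towerN (𝟭 D0)).CondA φ ∨ (towerN (𝟭 D0)).CondB φ) ∧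
    (¬ ∀ {X Y : (towerR (𝟭 D0)).F} (φ : X ⟶ Y), Mono φ →
        (towerR (𝟭 D0)).CondA φ ∨ (towerR (𝟭 D0)).CondB φ) := by
  refine ⟨fun h => ?_, fun h => ?_, fun h => ?_⟩
  · obtain ⟨X, Y, φ, hφ, ha, hb, -⟩ := towerA_id_exists_fsm_not_condA_not_condB
    exact (h φ hφ.2).elim ha hb
  · obtain ⟨X, Y, φ, hφ, ha, hb, -⟩ := towerN_id_exists_fsm_not_condA_not_condB
    exact (h φ hφ.2).elim ha hb
  · obtain ⟨X, Y, φ, hφ, ha, hb, -⟩ := towerR_id_exists_fsm_not_condA_not_condB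
    exact (h φ hφ.2).elim ha hb

/-! ### The "observation" of the printed proof of (iii) fails over `D₀` -/

/-- The observation of the proof of Prop. 3.4 (iii), p. 31 ll. 6–9 — "if `φ` is a fiberwise-surjective
morphism of `F` that does not satisfy condition (a) of assertion (ii), then the fiberwise-surjectivity
of `φ` implies [cf. Lemma 3.2, (ix)] that `φ` necessarily satisfies condition (b)" (the hypothesis
`hobs` of `Tower.propIII_of_propI_of_propII`) — is FALSE for `F = A` over `D = D₀`.
[cite: MochizukiFrdII2008, Prop 3.4 (iii) p.31] -/
theorem towerA_id_not_obs :
    ¬ ∀ ⦃X Y : (towerA (𝟭 D0)).F⦄ (φ : X ⟶ Y), IsFiberwiseSurjective φ →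
      ¬ (towerA (𝟭 D0)).CondA φ → (towerA (𝟭 D0)).CondB φ := by
  intro h
  obtain ⟨X, Y, φ, hφ, ha, hb, -⟩ := towerA_id_exists_fsm_not_condA_not_condB
  exact hb (h φ hφ.1 ha)

/-- The same observation is FALSE for `F = N` over `D = D₀`. [cite: MochizukiFrdII2008, Prop 3.4 (iii) p.31] -/
theorem towerN_id_not_obs :
    ¬ ∀ ⦃X Y : (towerN (𝟭 D0)).F⦄ (φ : X ⟶ Y), IsFiberwiseSurjective φ →
      ¬ (towerN (𝟭 D0)).CondA φ → (towerN (𝟭 D0)).CondB φ := by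
  intro h
  obtain ⟨X, Y, φ, hφ, ha, hb, -⟩ := towerN_id_exists_fsm_not_condA_not_condB
  exact hb (h φ hφ.1 ha)

/-- The same observation is FALSE for `F = R` over `D = D₀`. [cite: MochizukiFrdII2008, Prop 3.4 (iii) p.31] -/
theorem towerR_id_not_obs :
    ¬ ∀ ⦃X Y : (towerR (𝟭 D0)).F⦄ (φ : X ⟶ Y), IsFiberwiseSurjective φ →
      ¬ (towerR (𝟭 D0)).CondA φ → (towerR (𝟭 D0)).CondB φ := by
  intro h
  obtain ⟨X, Y, φ, hφ, ha, hb, -⟩ := towerR_id_exists_fsm_not_condA_not_condB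
  exact hb (h φ hφ.1 ha)

/-! ### F-0811 `Prop34_v`: refuted as typed, proved with the printed binders -/

/-- **FACT-LIST F-0811**: the universal closure of the typed item (v) — over an ARBITRARY base
`π : D ⥤ D₀`, without the standing hypothesis "`D` totally epimorphic" of Ex. 3.3 (i) — is FALSE
(abc-iut-w4-d092's witness `not_prop34_v_constReal` at `D := Type`, `π :=` the constant functor at
`Spec ℝ`). [cite: MochizukiFrdII2008, Prop 3.4 (v) p.30] -/
theorem not_forall_prop34_v :
    ¬ ∀ {D : Type 1} [Category.{0} D] (π : D ⥤ D0),
      Literature.AlgebraicGeometry.Frobenioids.ArchFrd.Prop34_v π :=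
  fun h => not_prop34_v_constReal (h ((Functor.const (Type)).obj D0.real))

/-- **Prop. 3.4 (v) with the printed binders** of Ex. 3.3 (i), p. 27 — "Let `D` be a connected, totally
epimorphic category" — for `F = A, N, R` over any such `D → D₀` (connectedness is not used:
`prop34_v_of_isTotallyEpimorphic`). [cite: MochizukiFrdII2008, Prop 3.4 (v) p.30] -/
theorem prop34_v_printed :
    ∀ {D : Type u} [Category.{v} D] (π : D ⥤ D0), IsGraphConnected D → IsTotallyEpimorphic D →
      Literature.AlgebraicGeometry.Frobenioids.ArchFrd.Prop34_v π :=
  fun π _ hD => prop34_v_of_isTotallyEpimorphic π hD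

/-- **Prop. 3.4 (v) at the printed base `D := D₀`, `π := 𝟭 D₀`** (`D₀` is totally epimorphic,
`D0.isTotallyEpimorphic`). [cite: MochizukiFrdII2008, Prop 3.4 (v) p.30] -/
theorem prop34_v_id : Literature.AlgebraicGeometry.Frobenioids.ArchFrd.Prop34_v (𝟭 D0) :=
  prop34_v_of_isTotallyEpimorphic (𝟭 D0) D0.isTotallyEpimorphic

end ArchFrd

end

end Literature.AlgebraicGeometry.Frobenioids
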